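import Summits.NavierStokesRegularity.NavierStokesRegularity.Theorems.TypeILiouvilleTypeIliouvilleNoTypeIIEternalSplitModL
import Literature.Analysis.FluidPDE.KNSSAxisymmetricNoSwirlHolds
import HarnessLib

/-!
# EEL′ on the AXISYMMETRIC-NO-SWIRL stratum, unconditionally (crux `TypeIliouvilleNoTypeII`,
# stmt-NavierStokesRegularity-0056; rigidity residual EEL′ of the pressure-free eternal split)

Helper file (theorems only).  The pressure-free eternal energy Liouville statement EEL′ — the
`hEEL` binder of `EternalSplit.typeIliouvilleNoTypeII_of_pressureFreeSlab_of_eternalLiouville`: a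
bounded eternal Oseen-mild smooth divergence-free `v`, `‖v‖ ≤ 2`, whose Albritton–Barker quantities
`A`, `C`, `E` are bounded by a finite `I` on ALL parabolic balls, has `v(0,0) = 0` — is OPEN; it
follows from KNSS's conjecture (L) (`eternalLiouvillePressureFree_of_liouvilleL`).  On the strata
where (L) is a THEOREM the same composition is unconditional.  Koch–Nadirashvili–Seregin–Šverák
proved (L) for bounded ancient solutions that are axisymmetric WITHOUT SWIRL (Acta Math. 203
(2009), Thm 5.2: `u(x, t) = (0, 0, b₃(t))`), and the tree holds this theorem PROVED
(`knss_axisymmetric_no_swirl'_holds`, file `KNSSAxisymmetricNoSwirlHolds`).  Hence: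

* `fderiv_eq_zero_of_axisymNoSwirl` — a bounded eternal Oseen-mild smooth divergence-free field
  whose slices are axisymmetric (about the `x₃`-axis) and swirl-free has `∇v ≡ 0` (time
  translates are bounded ancient mild solutions, `ImmortalZoom.isBoundedAncientMildSolution_translate`;
  KNSS Thm 5.2 makes each slice a.e. constant; continuity);
* `eternal_eq_zero_of_axisymNoSwirl_of_cknAEss_le` — if moreover `A_ess(v; Q) ≤ I ≠ ∞` on all
  parabolic balls then `v ≡ 0` (the `A`-bound kills the constants `b₃(t) e_z`,
  `slice_eq_zero_of_const_of_cknAEss_le`);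
* `eternalLiouvillePressureFree_axisymNoSwirl` — **EEL′ on the axisymmetric-no-swirl stratum**, in
  the exact `hEEL` hypothesis shape plus the two symmetry hypotheses (the `C`- and `E`-clauses are
  accepted and NOT used).

Read with the zoom package: a Type-II blow-up whose eternal zoom limit is axisymmetric without
swirl and inherits the `A`-bound is excluded — but axisymmetry of the original solution about a
FIXED axis does not pass to zoom limits centred off the axis, so this is a stratum of EEL′, not a
statement about axisymmetric blow-up.  WHAT THIS IS NOT: not NS; KNSS's (L) WITH swirl stays OPEN
(KNSS 2009, p. 10), and so does EEL′.
-/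

noncomputable section

-- the summit and its single problem share the name `NavierStokesRegularity` (D-0017 nested layout)
set_option linter.dupNamespace false

open Set Function Filter Topology MeasureTheory Metric
open scoped NNReal ENNReal

namespace Summit.NavierStokesRegularity.NavierStokesRegularity.Theorems.TypeIliouvilleNoTypeII.TypeIIZoom

open Literature.Analysis Literature.Analysis.FluidPDE
open Summit.NavierStokesRegularity.NavierStokesRegularity.Theorems.TypeIliouvilleNoTypeII.ImmortalZoom
  (isBoundedAncientMildSolution_translate)

variable {v : ℝ → EuclideanSpace ℝ (Fin 3) → EuclideanSpace ℝ (Fin 3)}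

/-- **KNSS Thm 5.2 on the eternal profile: axisymmetric swirl-free bounded eternal Oseen-mild
fields have `∇v ≡ 0`.**  For fixed `t`, the translate `w(s) = v(s + t + 1)` is a bounded ancient
mild solution in the tree's duality sense (`isBoundedAncientMildSolution_translate`) with
continuous, axisymmetric, swirl-free slices; KNSS's Theorem 5.2
(`knss_axisymmetric_no_swirl'_holds`, PROVED in the tree) at `s = -1` makes `v(t) = w(-1)` a.e. a
constant vector, continuity upgrades this to `v(t) ≡ b`, and the derivative of a constant vanishes.
[cite: KochNadirashviliSereginSverak2009, Thm 5.2 (arXiv:0709.3599 pp. 9–10)] -/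
theorem fderiv_eq_zero_of_axisymNoSwirl (hv : ContDiff ℝ (⊤ : ℕ∞) (uncurry v))
    (hdiv : ∀ t, VectorCalculus.IsDivFree (v t))
    (hmild : ∀ s t : ℝ, s < t → ∀ x, v t x = heatFlow (v s) (t - s) x - oseenDuhamel 1 s v v t x)
    (hbdd : ∃ C : ℝ, ∀ t x, ‖v t x‖ ≤ C) (haxi : ∀ t, IsAxisymmetric (v t))
    (hswirl : ∀ t, HasNoSwirl (v t)) (t : ℝ) (x : EuclideanSpace ℝ (Fin 3)) :
    fderiv ℝ (v t) x = 0 := by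
  have hcont : ∀ τ, Continuous (v τ) := fun τ => (hv.comp (contDiff_prodMk_right τ)).continuous
  obtain ⟨b, hb⟩ := knss_axisymmetric_no_swirl'_holds
    (isBoundedAncientMildSolution_translate v hv hdiv hmild hbdd (t + 1))
    (fun s _ => (hcont (s + (t + 1))).aestronglyMeasurable) (fun s _ => haxi (s + (t + 1)))
    (fun s _ => hswirl (s + (t + 1))) (-1) (by norm_num)
  have e : (-1 : ℝ) + (t + 1) = t := by ring
  have hb' : v t =ᵐ[volume] fun _ => b := by simpa only [e] using hb
  have hvt : v t = fun _ => b := ((hcont t).ae_eq_iff_eq volume continuous_const).1 hb'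
  rw [hvt]
  exact fderiv_const_apply b

/-- **Axisymmetric swirl-free bounded eternal Oseen-mild fields with bounded `A_ess` vanish.**  By
`fderiv_eq_zero_of_axisymNoSwirl` every slice is constant (indeed `b₃(t) e_z`); constants with
`A_ess(v; Q_r) ≤ I ≠ ∞` on all parabolic balls are zero (`slice_eq_zero_of_const_of_cknAEss_le`:
`A_ess ≥ ‖b‖² |B₁| r² → ∞`). [cite: KochNadirashviliSereginSverak2009, Thm 5.2 (arXiv:0709.3599 pp. 9–10)] -/
theorem eternal_eq_zero_of_axisymNoSwirl_of_cknAEss_le (hv : ContDiff ℝ (⊤ : ℕ∞) (uncurry v))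
    (hdiv : ∀ t, VectorCalculus.IsDivFree (v t))
    (hmild : ∀ s t : ℝ, s < t → ∀ x, v t x = heatFlow (v s) (t - s) x - oseenDuhamel 1 s v v t x)
    (hbdd : ∃ C : ℝ, ∀ t x, ‖v t x‖ ≤ C) (haxi : ∀ t, IsAxisymmetric (v t))
    (hswirl : ∀ t, HasNoSwirl (v t)) {I : ℝ≥0∞} (hI : I ≠ ⊤)
    (hA : ∀ r : ℝ, 0 < r → ∀ z : ℝ × EuclideanSpace ℝ (Fin 3), cknAEss r z v ≤ I)
    (t : ℝ) (x : EuclideanSpace ℝ (Fin 3)) : v t x = 0 := by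
  have h0 : ∀ (s : ℝ) (y : EuclideanSpace ℝ (Fin 3)), fderiv ℝ (v s) y = 0 :=
    fderiv_eq_zero_of_axisymNoSwirl hv hdiv hmild hbdd haxi hswirl
  have hconst : ∀ (s : ℝ) (y : EuclideanSpace ℝ (Fin 3)), v s y = v s 0 := fun s =>
    slice_const_of_fderiv_eq_zero hv (h0 s)
  have hc : Continuous fun s => v s 0 := hv.continuous.comp (continuous_id.prodMk continuous_const)
  exact slice_eq_zero_of_const_of_cknAEss_le hc hconst hI hA t x

variable (v) in
/-- **EEL′ holds on the axisymmetric-no-swirl stratum** — in the exact hypothesis shape of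
`EternalSplit.typeIliouvilleNoTypeII_of_pressureFreeSlab_of_eternalLiouville` (`hEEL`), restricted to
fields whose slices are axisymmetric about the `x₃`-axis and swirl-free: such a `v` with `A`, `C`,
`E` bounded by a finite `I` on all parabolic balls has `v(0, 0) = 0` (indeed `v ≡ 0`).  Unconditional:
KNSS's Liouville theorem IS proved on this stratum (Thm 5.2, tree theorem
`knss_axisymmetric_no_swirl'_holds`), and the `A`-clause removes the surviving constants
`b₃(t) e_z`; the `C`- and `E`-clauses are NOT used. [cite: KochNadirashviliSereginSverak2009, Thm 5.2 (arXiv:0709.3599 pp. 9–10)] -/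
theorem eternalLiouvillePressureFree_axisymNoSwirl
    (hv : ContDiff ℝ (⊤ : ℕ∞) (uncurry v)) (hdiv : ∀ t, VectorCalculus.IsDivFree (v t))
    (hmild : ∀ s t : ℝ, s < t → ∀ x, v t x = heatFlow (v s) (t - s) x - oseenDuhamel 1 s v v t x)
    (hbd : ∀ (t : ℝ) (x : EuclideanSpace ℝ (Fin 3)), ‖v t x‖ ≤ 2)
    (hI : ∃ I : ℝ≥0∞, I ≠ ⊤ ∧ ∀ r : ℝ, 0 < r → ∀ z : ℝ × EuclideanSpace ℝ (Fin 3),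
      cknAEss r z v ≤ I ∧ cknC r z v ≤ I ∧ cknE r z (fun s y => fderiv ℝ (v s) y) ≤ I)
    (haxi : ∀ t, IsAxisymmetric (v t)) (hswirl : ∀ t, HasNoSwirl (v t)) : v 0 0 = 0 := by
  obtain ⟨I, hItop, hball⟩ := hI
  exact eternal_eq_zero_of_axisymNoSwirl_of_cknAEss_le hv hdiv hmild ⟨2, hbd⟩ haxi hswirl hItop
    (fun r hr z => (hball r hr z).1) 0 0

end Summit.NavierStokesRegularity.NavierStokesRegularity.Theorems.TypeIliouvilleNoTypeII.TypeIIZoom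

end
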